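import Summits.MatrixMultiplication.MatrixMultiplication.Theorems.OutsiderSandwichNoCatalysis
import HarnessLib

/-!
# No padded exchange: `⟨B⟩ ⊠ C₁^{⊠N} ⋭ ⟨m⟩ ⊠ ⟨2,2,2⟩^{⊠N} ⊕ t₂` for every concise padding `t₂`

Route `OutsiderSandwich` (decomposition cell `decomp-mm`, lens 4 «minimal counterexample /
extremal reduction», gen 28, addendum), support for the aside leaf `BlockOneIsMM`
(stmt-MatrixMultiplication-27147).

**The engine** (`not_restrictsTo_padded`).  Let `s = ⟨B⟩ ⊠ P^{⊠N}` (`N ≥ 1`; `P` the pair-tensor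
form of the coupled Coppersmith–Winograd block `C₁`) and `t = ⟨m⟩ ⊠ ⟨2,2,2⟩^{⊠N} ⊕ t₂` with `t₂`
ANY tensor that is concise in slice form on its two vector legs.  If the OUTPUT legs of `s` and `t`
have the same size and the output leg of `t₂` is SMALLER than the input leg of `t`, then `s ⋭ t`.
Proof: write `t = (A, B, C)·s`; conciseness and the equal output formats make `Cᵀ` invertible and
`Bᵀ` injective (`slice_restrict`); `G = C⁻ᵀ·diag(sgn)·Bᵀ` satisfies `S^t_w · G w = 0` for all `w`
(kernel vectors of `OutsiderSandwichNoTightExchange`), the weights `id ± u` on the `⟨2,2,2⟩`-summand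
kill every `⟨2,2,2⟩`-output coordinate of `G w`, and `Bᵀ = diag(sgn)·Cᵀ·G` makes `w ↦ G w` an
injective linear map from the input space of `t` into the output space of `t₂` — impossible by
dimension.  No genericity and no spectral point (spectrally all instances read `F⟨2,2,2⟩ ≤ F(C₁)`).

**Instances.** `not_catalytic` (`OutsiderSandwichNoCatalysis`, `t₂ = ⟨k⟩ ⊠ P^{⊠N}`) is the case of
equal vector legs.  `not_spare_pairs` / `not_spare_inner`: `[⟨2,2,2⟩] + 2·[⟨1,1,2⟩] ≰ 2·[C₁]` and
`[⟨2,2,2⟩] + 2·[⟨1,2,1⟩] ≰ 2·[C₁]` — two coupled blocks do not yield one product plus the two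
left-over pairs as matrix–vector or inner products (formats `(8,6,8)`, `(6,8,8)` against
`(8,8,8)`); this answers the «spare-pair» question I-g28d of the g28 memo in the negative.
`not_scalar_padding`: `m·[⟨2,2,2⟩]^N + k·4^N ≰ (m+k)·[C₁]^N`.

## References
* D. Coppersmith, S. Winograd, *Matrix multiplication via arithmetic progressions*,
  J. Symbolic Comput. 9 (1990) 251–280, §7 (the coupled block). [CoppersmithWinograd1990]
* P. Bürgisser, M. Clausen, M. A. Shokrollahi, *Algebraic Complexity Theory*, Springer (1997),
  §14.4 (restriction, conciseness), (15.19). [BurgisserClausenShokrollahi1997]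
* M. Christandl, P. Vrana, J. Zuiddam, *Universal points in the asymptotic spectrum of tensors*,
  J. Amer. Math. Soc. 36 (2023), §1.1 (the semiring `T(ℂ)`). [ChristandlVranaZuiddam2023]
-/
noncomputable section
open scoped BigOperators Matrix
set_option linter.dupNamespace false
set_option autoImplicit false

namespace Summit.MatrixMultiplication.MatrixMultiplication.Theorems.OutsiderSandwichNoPadding

open Literature.Computability.AlgebraicComplexity
open Summit.MatrixMultiplication.MatrixMultiplication.Theorems.OutsiderSandwichCoupling (coupling₁)
open Summit.MatrixMultiplication.MatrixMultiplication.Theorems.OutsiderSandwichBlockNormalForm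
  (pairTensor coupling₁_restrictsTo_pairTensor pairTensor_restrictsTo_coupling₁)
open Summit.MatrixMultiplication.MatrixMultiplication.Theorems.OutsiderSandwichAmortised
  (mk_unit_kronecker_pow)
open Summit.MatrixMultiplication.MatrixMultiplication.Theorems.OutsiderSandwichNoTightExchange
open Summit.MatrixMultiplication.MatrixMultiplication.Theorems.OutsiderSandwichSliceConcise

/-! ## 1. Conciseness of a direct sum in slice form -/
section DirectSum
variable {ι₁ κ₁ μ₁ ι₂ κ₂ μ₂ : Type} [Fintype κ₁] [Fintype κ₂]

/-- A direct sum of input-concise tensors is input-concise (slice form).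
[cite: BurgisserClausenShokrollahi1997, §14.4] -/
theorem directSum_weight_eq_zero {t₁ : ι₁ → κ₁ → μ₁ → ℂ} {t₂ : ι₂ → κ₂ → μ₂ → ℂ}
    (h₁ : ∀ w, slice t₁ w = 0 → w = 0) (h₂ : ∀ w, slice t₂ w = 0 → w = 0)
    {w : κ₁ ⊕ κ₂ → ℂ} (h : slice (directSumTensor t₁ t₂) w = 0) : w = 0 := by
  rw [slice_directSum] at h
  have e₁ : slice t₁ (fun b => w (Sum.inl b)) = 0 := by
    ext a c; simpa using congrFun (congrFun h (Sum.inl a)) (Sum.inl c)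
  have e₂ : slice t₂ (fun b => w (Sum.inr b)) = 0 := by
    ext a c; simpa using congrFun (congrFun h (Sum.inr a)) (Sum.inr c)
  funext x
  rcases x with b | b
  · exact congrFun (h₁ _ e₁) b
  · exact congrFun (h₂ _ e₂) b

/-- A direct sum of output-concise tensors is output-concise (slice form).
[cite: BurgisserClausenShokrollahi1997, §14.4] -/
theorem directSum_vec_eq_zero [Fintype μ₁] [Fintype μ₂]
    {t₁ : ι₁ → κ₁ → μ₁ → ℂ} {t₂ : ι₂ → κ₂ → μ₂ → ℂ}
    (h₁ : ∀ ζ, (∀ w, (slice t₁ w).mulVec ζ = 0) → ζ = 0)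
    (h₂ : ∀ ζ, (∀ w, (slice t₂ w).mulVec ζ = 0) → ζ = 0)
    {ζ : μ₁ ⊕ μ₂ → ℂ} (h : ∀ w, (slice (directSumTensor t₁ t₂) w).mulVec ζ = 0) : ζ = 0 := by
  have e₁ : ζ ∘ Sum.inl = 0 := by
    refine h₁ _ fun w₁ => ?_
    have e := h (Sum.elim w₁ 0)
    rw [slice_directSum, Matrix.fromBlocks_mulVec] at e
    funext a
    have ea := congrFun e (Sum.inl a)
    simp only [Sum.elim_inl, Sum.elim_inr, Pi.zero_apply, Matrix.zero_mulVec, add_zero] at ea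
    exact ea
  have e₂ : ζ ∘ Sum.inr = 0 := by
    refine h₂ _ fun w₂ => ?_
    have e := h (Sum.elim 0 w₂)
    rw [slice_directSum, Matrix.fromBlocks_mulVec] at e
    funext a
    have ea := congrFun e (Sum.inr a)
    simp only [Sum.elim_inl, Sum.elim_inr, Pi.zero_apply, Matrix.zero_mulVec, zero_add] at ea
    exact ea
  funext x
  rcases x with c | c
  · exact congrFun e₁ c
  · exact congrFun e₂ c
end DirectSum

/-! ## 2. The engine -/
section Engine
variable {ι₂ κ₂ μ₂ : Type} [Fintype ι₂] [Fintype κ₂] [Fintype μ₂]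
variable {N m B : ℕ}

/-- **No padded exchange.** For `N ≥ 1` and ANY padding `t₂` concise in slice form on both
vector legs: if the output legs of `⟨B⟩ ⊠ P^{⊠N}` and `⟨m⟩ ⊠ ⟨2,2,2⟩^{⊠N} ⊕ t₂` have the same
size and the output leg of `t₂` is smaller than the input leg of `⟨m⟩ ⊠ ⟨2,2,2⟩^{⊠N} ⊕ t₂`, then
`⟨B⟩ ⊠ P^{⊠N} ⋭ ⟨m⟩ ⊠ ⟨2,2,2⟩^{⊠N} ⊕ t₂`. [cite: CoppersmithWinograd1990, §7] -/
theorem not_restrictsTo_padded (hN : 1 ≤ N) (t₂ : ι₂ → κ₂ → μ₂ → ℂ)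
    (hY : ∀ w, slice t₂ w = 0 → w = 0)
    (hZ : ∀ ζ, (∀ w, (slice t₂ w).mulVec ζ = 0) → ζ = 0)
    (hcardZ : Fintype.card (J N m ⊕ μ₂) = Fintype.card (J N B))
    (hcardY : Fintype.card μ₂ < Fintype.card (J N m ⊕ κ₂)) :
    ¬ TensorRestrictsTo (src N B) (directSumTensor (tgt N m) t₂) := by
  classical
  rintro ⟨A, B', C, hABC⟩
  set Bt : Matrix (J N B) (J N m ⊕ κ₂) ℂ := (Matrix.of B')ᵀ with hBt
  set Ct : Matrix (J N B) (J N m ⊕ μ₂) ℂ := (Matrix.of C)ᵀ with hCt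
  have hw : ∀ w' : J N m ⊕ κ₂ → ℂ, (fun b => ∑ b', w' b' * B' b' b) = Bt.mulVec w' := by
    intro w'; funext b
    simp only [hBt, Matrix.mulVec, dotProduct, Matrix.transpose_apply, Matrix.of_apply]
    exact Finset.sum_congr rfl fun b' _ => mul_comm _ _
  have key : ∀ w' : J N m ⊕ κ₂ → ℂ, slice (directSumTensor (tgt N m) t₂) w' =
      Matrix.of A * slice (src N B) (Bt.mulVec w') * Ct := by
    intro w'
    rw [← hw w']
    exact slice_restrict A B' C hABC w'
  have hCinj : ∀ ζ, Ct.mulVec ζ = 0 → ζ = 0 := by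
    intro ζ hζ
    refine directSum_vec_eq_zero (fun ζ h => tgt_vec_eq_zero N m h) hZ fun w' => ?_
    rw [key w', ← Matrix.mulVec_mulVec, ← Matrix.mulVec_mulVec, hζ, Matrix.mulVec_zero,
      Matrix.mulVec_zero]
  obtain ⟨D, hCD, -⟩ := exists_two_sided_inv Ct hcardZ hCinj
  have hBinj : ∀ w', Bt.mulVec w' = 0 → w' = 0 := by
    intro w' hw'
    refine directSum_weight_eq_zero (fun w h => tgt_weight_eq_zero N m h) hY ?_
    rw [key w', hw', slice_zero, Matrix.mul_zero, Matrix.zero_mul]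
  set Sg : Matrix (J N B) (J N B) ℂ := Matrix.diagonal (sgn (m := B) hN) with hSg
  have hdiag : Sg * Sg = 1 := by
    rw [hSg, Matrix.diagonal_mul_diagonal, ← Matrix.diagonal_one]
    congr 1; funext z; exact sgn_mul_self hN z
  set G : Matrix (J N m ⊕ μ₂) (J N m ⊕ κ₂) ℂ := D * Sg * Bt with hG
  have hGB : Sg * (Ct * G) = Bt := by
    simp only [hG, ← Matrix.mul_assoc]
    rw [Matrix.mul_assoc Sg Ct D, hCD, Matrix.mul_one, hdiag, Matrix.one_mul]
  have hann : ∀ w', (slice (directSumTensor (tgt N m) t₂) w').mulVec (G.mulVec w') = 0 := by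
    intro w'
    have hκ : G.mulVec w' = D.mulVec (fun z => sgn hN z * Bt.mulVec w' z) := by
      rw [hG, ← Matrix.mulVec_mulVec, ← Matrix.mulVec_mulVec]
      congr 1; funext z; rw [hSg]; exact Matrix.mulVec_diagonal _ _ z
    have hback : Ct.mulVec (D.mulVec fun z => sgn hN z * Bt.mulVec w' z) =
        fun z => sgn hN z * Bt.mulVec w' z := by
      rw [Matrix.mulVec_mulVec, hCD, Matrix.one_mulVec]
    rw [key w', hκ, ← Matrix.mulVec_mulVec, ← Matrix.mulVec_mulVec, hback, slice_mulVec_sgn hN,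
      Matrix.mulVec_zero]
  have hM : ∀ (w₁ : J N m → ℂ) (w₂ : κ₂ → ℂ),
      (slice (tgt N m) w₁).mulVec (G.mulVec (Sum.elim w₁ w₂) ∘ Sum.inl) = 0 := by
    intro w₁ w₂
    have e := hann (Sum.elim w₁ w₂)
    rw [slice_directSum, Matrix.fromBlocks_mulVec] at e
    funext a
    have ea := congrFun e (Sum.inl a)
    simp only [Sum.elim_inl, Sum.elim_inr, Pi.zero_apply, Matrix.zero_mulVec, add_zero] at ea
    exact ea
  have hlin : ∀ (w₁ w₁' : J N m → ℂ) (w₂ w₂' : κ₂ → ℂ),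
      G.mulVec (Sum.elim (w₁ + w₁') (w₂ + w₂')) ∘ Sum.inl =
        G.mulVec (Sum.elim w₁ w₂) ∘ Sum.inl + G.mulVec (Sum.elim w₁' w₂') ∘ Sum.inl := by
    intro w₁ w₁' w₂ w₂'
    rw [sum_elim_add, Matrix.mulVec_add]; rfl
  have hneg : ∀ (w₁ : J N m → ℂ) (w₂ : κ₂ → ℂ),
      G.mulVec (Sum.elim (-w₁) (-w₂)) ∘ Sum.inl = -(G.mulVec (Sum.elim w₁ w₂) ∘ Sum.inl) := by
    intro w₁ w₂
    rw [sum_elim_neg, Matrix.mulVec_neg]; rfl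
  have hid : ∀ w₂ : κ₂ → ℂ, G.mulVec (Sum.elim (idWeight N m) w₂) ∘ Sum.inl = 0 := by
    intro w₂
    simpa [slice_tgt_idWeight] using hM (idWeight N m) w₂
  have hzero : ∀ w₂ : κ₂ → ℂ, G.mulVec (Sum.elim 0 w₂) ∘ Sum.inl = 0 := by
    intro w₂
    have e := hlin (idWeight N m) 0 0 w₂
    rw [add_zero, zero_add, hid, hid, zero_add] at e
    exact e.symm
  have hu : ∀ u : J N m → ℂ, G.mulVec (Sum.elim u 0) ∘ Sum.inl = 0 := by
    intro u
    have hp := hM (idWeight N m + u) (0 + 0)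
    rw [hlin, hid, zero_add, slice_add, slice_tgt_idWeight, Matrix.add_mulVec,
      Matrix.one_mulVec] at hp
    have hn := hM (idWeight N m + -u) (0 + -0)
    rw [hlin, hid, zero_add, hneg, slice_add, slice_neg, slice_tgt_idWeight, Matrix.add_mulVec,
      Matrix.one_mulVec, Matrix.neg_mulVec, Matrix.mulVec_neg, neg_neg] at hn
    have hS : (slice (tgt N m) u).mulVec (G.mulVec (Sum.elim u 0) ∘ Sum.inl) = 0 := by
      have e := congrArg₂ (· + ·) hp hn
      rw [add_zero, add_add_add_comm, add_neg_cancel, zero_add, ← two_smul ℂ] at e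
      exact (smul_eq_zero.mp e).resolve_left two_ne_zero
    rw [hS, add_zero] at hp
    exact hp
  have hrow : ∀ w' : J N m ⊕ κ₂ → ℂ, G.mulVec w' ∘ Sum.inl = 0 := by
    intro w'
    have hsplit : w' = Sum.elim (fun b => w' (Sum.inl b)) (0 : κ₂ → ℂ)
        + Sum.elim (0 : J N m → ℂ) (fun b => w' (Sum.inr b)) := by
      funext x; rcases x with x | x <;> simp
    rw [hsplit, Matrix.mulVec_add]
    funext z
    have e1 := congrFun (hu fun b => w' (Sum.inl b)) z
    have e2 := congrFun (hzero fun b => w' (Sum.inr b)) z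
    simp only [Function.comp_apply, Pi.zero_apply] at e1 e2
    simp only [Function.comp_apply, Pi.add_apply, Pi.zero_apply, e1, e2, add_zero]
  have hGinj : ∀ w', G.mulVec w' = 0 → w' = 0 := by
    intro w' h0
    refine hBinj w' ?_
    rw [← hGB, ← Matrix.mulVec_mulVec, ← Matrix.mulVec_mulVec, h0, Matrix.mulVec_zero,
      Matrix.mulVec_zero]
  let φ : (J N m ⊕ κ₂ → ℂ) →ₗ[ℂ] (μ₂ → ℂ) :=
    (LinearMap.funLeft ℂ ℂ (Sum.inr : μ₂ → J N m ⊕ μ₂)).comp (Matrix.mulVecLin G)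
  have hφ : Function.Injective φ := by
    intro v v' hvv'
    have h0 : φ (v - v') = 0 := by rw [map_sub, hvv', sub_self]
    refine sub_eq_zero.mp (hGinj _ ?_)
    funext x
    rcases x with z | c
    · exact congrFun (hrow (v - v')) z
    · have := congrFun h0 c
      simpa [φ, LinearMap.funLeft_apply, Matrix.mulVecLin_apply] using this
  have hle := LinearMap.finrank_le_finrank_of_injective hφ
  rw [Module.finrank_fintype_fun_eq_card, Module.finrank_fintype_fun_eq_card] at hle
  exact absurd hcardY (not_lt.mpr hle)
end Engine

/-! ## 3. Instances: spare pairs and scalar padding -/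

section Instances
/-- `[C₁] = [P]` in `T(ℂ)` (pair-tensor normal form). [cite: CoppersmithWinograd1990, §7] -/
theorem mk_coupling₁ : TensorClass.mk coupling₁ = TensorClass.mk (pairTensor 2) :=
  le_antisymm (TensorClass.mk_le_mk_iff.2 pairTensor_restrictsTo_coupling₁)
    (TensorClass.mk_le_mk_iff.2 coupling₁_restrictsTo_pairTensor)

/-- The slices of `⟨1,1,2⟩` (outputs `Z ∈ ℂ^{1×2}`, inputs `X ∈ ℂ^{1×1}`, `Y ∈ ℂ^{1×2}`) along
the `X`-leg are the scalar matrices. [cite: BurgisserClausenShokrollahi1997, §14.4] -/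
theorem slice_matMul112 (w : Fin 1 × Fin 1 → ℂ) :
    slice (matMulTensor ℂ 1 1 2) w = w (0, 0) • (1 : Matrix (Fin 1 × Fin 2) (Fin 1 × Fin 2) ℂ) := by
  ext a c
  simp only [slice_apply, Fintype.sum_prod_type, Fintype.sum_unique, Fin.default_eq_zero,
    Matrix.smul_apply, Matrix.one_apply, smul_eq_mul, Prod.ext_iff, matMulTensor]
  simp [eq_iff_true_of_subsingleton]

/-- `⟨1,1,2⟩` is input-concise in slice form. [cite: BurgisserClausenShokrollahi1997, §14.4] -/
theorem matMul112_weight_eq_zero (w : Fin 1 × Fin 1 → ℂ)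
    (h : slice (matMulTensor ℂ 1 1 2) w = 0) : w = 0 := by
  rw [slice_matMul112] at h
  have e := congrFun (congrFun h ((0 : Fin 1), (0 : Fin 2))) ((0 : Fin 1), (0 : Fin 2))
  simp only [Matrix.smul_apply, Matrix.one_apply_eq, smul_eq_mul, mul_one,
    Matrix.zero_apply] at e
  funext x
  rw [Pi.zero_apply, ← e]; congr 1; exact Subsingleton.elim _ _

/-- `⟨1,1,2⟩` is output-concise in slice form. [cite: BurgisserClausenShokrollahi1997, §14.4] -/
theorem matMul112_vec_eq_zero (ζ : Fin 1 × Fin 2 → ℂ)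
    (h : ∀ w, (slice (matMulTensor ℂ 1 1 2) w).mulVec ζ = 0) : ζ = 0 := by
  have e := h fun _ => 1
  rwa [slice_matMul112, one_smul, Matrix.one_mulVec] at e

/-- **No spare pairs** (pair-tensor form): `⟨2⟩ ⊠ P ⋭ ⟨1⟩ ⊠ ⟨2,2,2⟩ ⊕ (⟨1,1,2⟩ ⊕ ⟨1,1,2⟩)`
(formats `(8,8,8)` against `(8,6,8)`). [cite: CoppersmithWinograd1990, §7] -/
theorem not_spare_pairs_src : ¬ TensorRestrictsTo (src 1 2) (directSumTensor (tgt 1 1)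
    (directSumTensor (matMulTensor ℂ 1 1 2) (matMulTensor ℂ 1 1 2))) := by
  refine not_restrictsTo_padded (le_refl 1) _
    (fun w h => directSum_weight_eq_zero matMul112_weight_eq_zero matMul112_weight_eq_zero h)
    (fun ζ h => directSum_vec_eq_zero matMul112_vec_eq_zero matMul112_vec_eq_zero h) ?_ ?_
  · simp [J, Fintype.card_sum, Fintype.card_prod, Fintype.card_fin]
  · simp [J, Fintype.card_sum, Fintype.card_prod, Fintype.card_fin]

/-- **No spare pairs**, in the semiring: `[⟨2,2,2⟩] + 2·[⟨1,1,2⟩] ≰ 2·[C₁]` — two coupled blocks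
do not restrict to one `2 × 2` product together with the two left-over matrix–vector pairs
(the padded inequality that would have given `a(1,3) = 4`). [cite: CoppersmithWinograd1990, §7] -/
theorem not_spare_pairs :
    ¬ (TensorClass.mk (matMulTensor ℂ 2 2 2) + 2 * TensorClass.mk (matMulTensor ℂ 1 1 2)
        ≤ 2 * TensorClass.mk coupling₁) := by
  intro h
  have h1 : TensorClass.mk (tgt 1 1) = TensorClass.mk (matMulTensor ℂ 2 2 2) := by
    rw [mk_unit_kronecker_pow (matMulTensor ℂ 2 2 2) 1 1, Nat.cast_one, one_mul, pow_one]
  have h2 : TensorClass.mk (src 1 2) = 2 * TensorClass.mk (pairTensor 2) := by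
    rw [mk_unit_kronecker_pow (pairTensor 2) 2 1, Nat.cast_ofNat, pow_one]
  rw [mk_coupling₁, ← h2, ← h1, two_mul, TensorClass.mk_add_mk, TensorClass.mk_add_mk,
    TensorClass.mk_le_mk_iff] at h
  exact not_spare_pairs_src h

/-- **No spare pairs** (tensor form): `⟨2⟩ ⊠ C₁ ⋭ ⟨2,2,2⟩ ⊕ (⟨1,1,2⟩ ⊕ ⟨1,1,2⟩)`.
[cite: CoppersmithWinograd1990, §7] -/
theorem not_spare_pairs_tensor :
    ¬ TensorRestrictsTo (kroneckerTensor (unitTensor ℂ 2) coupling₁)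
        (directSumTensor (matMulTensor ℂ 2 2 2)
          (directSumTensor (matMulTensor ℂ 1 1 2) (matMulTensor ℂ 1 1 2))) := by
  intro h
  apply not_spare_pairs
  have h' := TensorClass.mk_le_mk_iff.2 h
  rwa [← TensorClass.mk_add_mk, ← TensorClass.mk_add_mk, ← TensorClass.mk_mul_mk,
    ← TensorClass.natCast_eq_mk, Nat.cast_ofNat, ← two_mul] at h'

/-- The slices of `⟨1,2,1⟩` (the inner product: `X ∈ ℂ^{1×2}`, `Y ∈ ℂ^{2×1}`, `Z ∈ ℂ^{1×1}`)
along the `X`-leg are the row vectors. [cite: BurgisserClausenShokrollahi1997, §14.4] -/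
theorem slice_matMul121 (w : Fin 1 × Fin 2 → ℂ) :
    slice (matMulTensor ℂ 1 2 1) w = Matrix.of fun _ c => w (0, c.1) := by
  ext a c
  simp only [slice_apply, Fintype.sum_prod_type, Fintype.sum_unique, Fin.default_eq_zero,
    Fin.sum_univ_two, Matrix.of_apply, matMulTensor]
  rcases c with ⟨c, c'⟩
  fin_cases c <;> simp [eq_iff_true_of_subsingleton]

/-- `⟨1,2,1⟩` is input-concise in slice form. [cite: BurgisserClausenShokrollahi1997, §14.4] -/
theorem matMul121_weight_eq_zero (w : Fin 1 × Fin 2 → ℂ)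
    (h : slice (matMulTensor ℂ 1 2 1) w = 0) : w = 0 := by
  rw [slice_matMul121] at h
  funext ⟨i, j⟩
  obtain rfl : i = 0 := Subsingleton.elim _ _
  exact congrFun (congrFun h ((0 : Fin 1), (0 : Fin 1))) (j, (0 : Fin 1))

/-- `⟨1,2,1⟩` is output-concise in slice form. [cite: BurgisserClausenShokrollahi1997, §14.4] -/
theorem matMul121_vec_eq_zero (ζ : Fin 2 × Fin 1 → ℂ)
    (h : ∀ w, (slice (matMulTensor ℂ 1 2 1) w).mulVec ζ = 0) : ζ = 0 := by
  funext ⟨j, i⟩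
  obtain rfl : i = 0 := Subsingleton.elim _ _
  have e := congrFun (h fun b => if b = ((0 : Fin 1), j) then 1 else 0) ((0 : Fin 1), (0 : Fin 1))
  rw [slice_matMul121] at e
  simp only [Matrix.mulVec, dotProduct, Matrix.of_apply, Fintype.sum_prod_type,
    Fintype.sum_unique, Fin.default_eq_zero, Fin.sum_univ_two, Prod.mk.injEq, true_and,
    Pi.zero_apply] at e
  fin_cases j <;> simpa using e

/-- **No spare inner products**, in the semiring: `[⟨2,2,2⟩] + 2·[⟨1,2,1⟩] ≰ 2·[C₁]` (formats
`(8,8,8)` against `(6,8,8)`). [cite: CoppersmithWinograd1990, §7] -/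
theorem not_spare_inner :
    ¬ (TensorClass.mk (matMulTensor ℂ 2 2 2) + 2 * TensorClass.mk (matMulTensor ℂ 1 2 1)
        ≤ 2 * TensorClass.mk coupling₁) := by
  intro h
  have h1 : TensorClass.mk (tgt 1 1) = TensorClass.mk (matMulTensor ℂ 2 2 2) := by
    rw [mk_unit_kronecker_pow (matMulTensor ℂ 2 2 2) 1 1, Nat.cast_one, one_mul, pow_one]
  have h2 : TensorClass.mk (src 1 2) = 2 * TensorClass.mk (pairTensor 2) := by
    rw [mk_unit_kronecker_pow (pairTensor 2) 2 1, Nat.cast_ofNat, pow_one]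
  rw [mk_coupling₁, ← h2, ← h1, two_mul, TensorClass.mk_add_mk, TensorClass.mk_add_mk,
    TensorClass.mk_le_mk_iff] at h
  refine not_restrictsTo_padded (le_refl 1) _
    (fun w h => directSum_weight_eq_zero matMul121_weight_eq_zero matMul121_weight_eq_zero h)
    (fun ζ h => directSum_vec_eq_zero matMul121_vec_eq_zero matMul121_vec_eq_zero h) ?_ ?_ h
  · simp [J, Fintype.card_sum, Fintype.card_prod, Fintype.card_fin]
  · simp [J, Fintype.card_sum, Fintype.card_prod, Fintype.card_fin]

/-- The slices of the unit tensor `⟨n⟩` are the diagonal matrices.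
[cite: BurgisserClausenShokrollahi1997, §14.4] -/
theorem slice_unitTensor (n : ℕ) (w : Fin n → ℂ) :
    slice (unitTensor ℂ n) w = Matrix.diagonal w := by
  ext a c
  rw [slice_apply, Finset.sum_eq_single a]
  · by_cases h : a = c
    · subst h; simp [unitTensor_apply]
    · simp [unitTensor_apply, h]
  · intro b _ hb; simp [unitTensor_apply, Ne.symm hb]
  · intro ha; exact absurd (Finset.mem_univ a) ha

/-- `⟨n⟩` is input-concise in slice form. [cite: BurgisserClausenShokrollahi1997, §14.4] -/
theorem unitTensor_weight_eq_zero (n : ℕ) (w : Fin n → ℂ) (h : slice (unitTensor ℂ n) w = 0) :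
    w = 0 := by
  funext i
  have e := congrFun (congrFun h i) i
  rwa [slice_unitTensor, Matrix.diagonal_apply_eq] at e

/-- `⟨n⟩` is output-concise in slice form. [cite: BurgisserClausenShokrollahi1997, §14.4] -/
theorem unitTensor_vec_eq_zero (n : ℕ) (ζ : Fin n → ℂ)
    (h : ∀ w, (slice (unitTensor ℂ n) w).mulVec ζ = 0) : ζ = 0 := by
  have e := h fun _ => 1
  rwa [slice_unitTensor, Matrix.diagonal_one, Matrix.one_mulVec] at e

/-- **No scalar padding** (pair-tensor form): for `N, m ≥ 1` and every `k`,
`⟨m+k⟩ ⊠ P^{⊠N} ⋭ ⟨m⟩ ⊠ ⟨2,2,2⟩^{⊠N} ⊕ ⟨k·4^N⟩`. [cite: CoppersmithWinograd1990, §7] -/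
theorem not_scalar_padding_src {N m : ℕ} (hN : 1 ≤ N) (hm : 1 ≤ m) (k : ℕ) :
    ¬ TensorRestrictsTo (src N (m + k))
        (directSumTensor (tgt N m) (unitTensor ℂ (k * 4 ^ N))) := by
  refine not_restrictsTo_padded hN _ (unitTensor_weight_eq_zero _) (unitTensor_vec_eq_zero _)
    ?_ ?_
  · simp only [J, Fintype.card_sum, Fintype.card_prod, Fintype.card_fin, Fintype.card_fun]
    ring
  · simp only [J, Fintype.card_sum, Fintype.card_prod, Fintype.card_fin, Fintype.card_fun]
    have : 0 < m * (2 * 2) ^ N := by positivity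
    omega

/-- **No scalar padding**, in the semiring: for `N, m ≥ 1` and every `k`,
`m·[⟨2,2,2⟩]^N + k·4^N ≰ (m+k)·[C₁]^N` — converting `m` coupled blocks out of `m+k` cannot even be
paid for with `k·4^N` independent scalar products. [cite: CoppersmithWinograd1990, §7] -/
theorem not_scalar_padding {N m : ℕ} (hN : 1 ≤ N) (hm : 1 ≤ m) (k : ℕ) :
    ¬ ((m : TensorClass ℂ) * TensorClass.mk (matMulTensor ℂ 2 2 2) ^ N
        + ((k * 4 ^ N : ℕ) : TensorClass ℂ)
        ≤ ((m + k : ℕ) : TensorClass ℂ) * TensorClass.mk coupling₁ ^ N) := by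
  intro h
  rw [mk_coupling₁, ← mk_unit_kronecker_pow (matMulTensor ℂ 2 2 2) m N,
    ← mk_unit_kronecker_pow (pairTensor 2) (m + k) N, TensorClass.natCast_eq_mk,
    TensorClass.mk_add_mk, TensorClass.mk_le_mk_iff] at h
  exact not_scalar_padding_src hN hm k h
end Instances

end Summit.MatrixMultiplication.MatrixMultiplication.Theorems.OutsiderSandwichNoPadding
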